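import Literature.AlgebraicGeometry.Deformation.MorphismLiftsSquareZeroAffine
import Mathlib.AlgebraicGeometry.Morphisms.Smooth
import HarnessLib

/-!
# Lifts across a nilpotent thickening of an AFFINE scheme into a SMOOTH target EXIST (SGA 1 III Cor. 5.2, sections over an affine open)

Layer `Literature/AlgebraicGeometry/Deformation`, namespace `Literature.AlgebraicGeometry.Deformation`.  THEOREMS ONLY (no definition, no named
fact, no instance).  Sequel of ★ `Deformation/MorphismLiftsSquareZeroAffine` (A-p08 (g11), p737594: [SGA1] Exp. III Prop. 5.1 on an affine open —
the lifts of `g₀` through an affine open `V ⊆ X` form a formally principal homogeneous space under `Der_{R₀}(Γ(X, V), ker π)`), whose docstring defers the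
EXISTENCE of lifts: «Smoothness of `X → S` is NOT needed for this (formal) half; it enters only the existence of local lifts ([SGA1, Exp. III Cor. 5.2])».
This file is that existence half, read on the same charts.

[SGA1, Exp. III §5, Cor. 5.2 (of Prop. 5.1)]: for `X` SMOOTH over `S` the sheaf `𝒫(g₀)` of local extensions of `g₀ : Y₀ → X` across the square-zero
thickening `Y₀ ↪ Y` is a TORSOR under `𝒢 = 𝓗om(g₀^*Ω¹_{X/S}, 𝒥)` — i.e. in addition to Prop. 5.1 it is LOCALLY NON-EMPTY, because a smooth morphism is
formally smooth ([EGAIV4] 17.1.1 / [StacksProject] Tag 02H6: `X(Y) → X(Y₀)` is surjective for AFFINE `Y`).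

* `formallySmooth_sections_of_smooth` — for `p : X → Spec R₀` smooth and an affine open `V ⊆ X`, the sections `Γ(X, V)` are a formally smooth
  `R₀`-algebra for the scalar map `s_V = ΓSpecIso⁻¹ ≫ p.appLE ⊤ V` of ★ `MorphismLiftsSquareZeroAffine` (Mathlib: `Smooth` is the `HasRingHomProperty`
  of `RingHom.Smooth`; `RingHom.Smooth.respectsIso`; `Algebra.Smooth.formallySmooth`);
* **`exists_lift_of_smooth_affine`** — for `p : X → Spec R₀` smooth, `V ⊆ X` affine open, `π : B →ₐ[R₀] B₀` surjective with NILPOTENT kernel (e.g.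
  square zero) and an `R₀`-morphism `f₀ : Spec B₀ → X` landing in `V`, there is an `R₀`-morphism `g : Spec B → X` landing in `V` with `Spec π ≫ g = f₀`
  (chart `ψ₀` of `f₀` ★ `eq_specMap_appLE_comp_fromSpec`, an `R₀`-algebra map by ★ `comp_eq_specMap_algebraMap_iff`, lifted along `π` by Mathlib
  `Algebra.FormallySmooth.liftOfSurjective`; `g := Spec (lift) ≫ (V ↪ X)`, reduction by ★ `specMap_comp_specMap_comp_fromSpec`).

Together with ★ `existsUnique_derivation_of_lifts` / `exists_lift_of_derivation` (Prop. 5.1) and ★ `MorphismLiftsSquareZeroAffineFunctorial`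
(naturality, p738652): on an affine open `Spec B` of the thickened scheme whose image lies in an affine open of the smooth target, `𝒫(f₀)(Spec B)` is a
NON-EMPTY principal homogeneous space under `Der_{R₀}(Γ(X, V), ker π)`.  Cell hodgecm-mathlib (D-0151), SOCKETS-F §4 (α) «EQUIDIM BY PROOF», node E3
brick DEF-MOR (i) (A-p01 (g8) census `E-census-E3E5` §1.3 row E3.1 (i) «local lifts on affines `U ⊆ f₀⁻¹(V)`, `V ⊆ Y` affine»); count-neutral generic
capital.  HC_CM is proved only modulo the 7 printed citations until rung 0 closes; this file discharges none of them.

## References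
* [SGA1] A. Grothendieck, M. Raynaud, *Revêtements étales et groupe fondamental (SGA 1)*, LNM 224 (1971) / arXiv:math/0206203: Exp. III §5 Prop. 5.1 and
  Cor. 5.2 (p. 71 of the arXiv edition).
* [StacksProject] Tag 02H6 (smooth ring maps are formally smooth), Tag 02GZ (formally smooth morphisms: lifting along first-order thickenings of affines).
* [EGAIV4] A. Grothendieck, EGA IV₄, Publ. Math. IHÉS 32 (1967), Déf. 17.1.1, Prop. 17.1.6.
-/

universe u

open CategoryTheory CategoryTheory.Limits AlgebraicGeometry

noncomputable section

namespace Literature.AlgebraicGeometry.Deformation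

variable {X : Scheme.{u}} {V : X.Opens} {R₀ B B₀ : Type u} [CommRing R₀] [CommRing B] [CommRing B₀]
  [Algebra R₀ B] [Algebra R₀ B₀] (p : X ⟶ Spec (.of R₀)) (π : B →ₐ[R₀] B₀)

/-- The coordinate ring of an affine open of a SMOOTH `R₀`-scheme is a smooth, hence formally smooth, `R₀`-algebra for the
scalar map `s_V = ΓSpecIso⁻¹ ≫ p.appLE ⊤ V` (Mathlib: `Smooth` is the `HasRingHomProperty` of `RingHom.Smooth`, read on the
affine opens `⊤ ⊆ Spec R₀`, `V ⊆ X`). [cite: SGA1, Exp. III §5 Cor. 5.2] [cite: StacksProject, Tag 02H6] -/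
theorem formallySmooth_sections_of_smooth (hV : IsAffineOpen V) [Smooth p] :
    letI : Algebra R₀ Γ(X, V) := ((Scheme.ΓSpecIso (.of R₀)).inv ≫ p.appLE ⊤ V le_top).hom.toAlgebra
    Algebra.FormallySmooth R₀ Γ(X, V) := by
  have h1 : (p.appLE ⊤ V le_top).hom.Smooth :=
    HasRingHomProperty.appLE @Smooth p inferInstance ⟨⊤, isAffineOpen_top _⟩ ⟨V, hV⟩ le_top
  have h2 : ((Scheme.ΓSpecIso (.of R₀)).inv ≫ p.appLE ⊤ V le_top).hom.Smooth :=
    (RingHom.Smooth.respectsIso.cancel_left_isIso (Scheme.ΓSpecIso (.of R₀)).inv (p.appLE ⊤ V le_top)).mpr h1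
  letI : Algebra R₀ Γ(X, V) := ((Scheme.ΓSpecIso (.of R₀)).inv ≫ p.appLE ⊤ V le_top).hom.toAlgebra
  have h3 : Algebra.Smooth R₀ Γ(X, V) := h2
  exact h3.formallySmooth

/-- **DEF-MOR (i) — lifts into a smooth target exist on affine pieces** ([SGA1] Exp. III Cor. 5.2: for `X → S` SMOOTH the sheaf
`𝒫(g₀)` of local extensions is locally non-empty; [StacksProject] Tag 02H6 «smooth ⇒ formally smooth»).  Data: `p : X → Spec R₀`
smooth, an affine open `V ⊆ X`; a surjection of `R₀`-algebras `π : B → B₀` with NILPOTENT kernel (e.g. square-zero: the thickening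
`Spec B₀ ↪ Spec B`); an `R₀`-morphism `f₀ : Spec B₀ → X` landing in `V`.  Then `f₀` extends to an `R₀`-morphism `g : Spec B → X`
landing in `V` (`Spec π ≫ g = f₀`): the chart `ψ₀ : Γ(X, V) → B₀` of `f₀` (★ `eq_specMap_appLE_comp_fromSpec`) is an `R₀`-algebra map
(★ `comp_eq_specMap_algebraMap_iff`), `Γ(X, V)` is formally smooth over `R₀` (`formallySmooth_sections_of_smooth`), so `ψ₀` lifts along
`π` (Mathlib `Algebra.FormallySmooth.liftOfSurjective`), and `g := Spec (lift) ≫ (V ↪ X)`.  With ★ A-p08 (g11)՚s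
`existsUnique_derivation_of_lifts` / `exists_lift_of_derivation` (the torsor, DEF-MOR (ii)) this is [SGA1] III Prop. 5.1 + Cor. 5.2
read on the affine open `Spec B`: `𝒫(f₀)(Spec B)` is a (non-empty) principal homogeneous space under `Der_{R₀}(Γ(X, V), ker π)`.
[cite: SGA1, Exp. III §5 Prop. 5.1 and Cor. 5.2] [cite: StacksProject, Tag 02H6] -/
theorem exists_lift_of_smooth_affine (hV : IsAffineOpen V) [Smooth p] (hπ : Function.Surjective π)
    (hnil : IsNilpotent (RingHom.ker (π : B →+* B₀))) (f₀ : Spec (.of B₀) ⟶ X)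
    (w₀ : f₀ ≫ p = Spec.map (CommRingCat.ofHom (algebraMap R₀ B₀))) (hf₀ : f₀ ⁻¹ᵁ V = ⊤) :
    ∃ (g : Spec (.of B) ⟶ X) (_ : g ⁻¹ᵁ V = ⊤),
      g ≫ p = Spec.map (CommRingCat.ofHom (algebraMap R₀ B)) ∧
      Spec.map (CommRingCat.ofHom (π : B →+* B₀)) ≫ g = f₀ := by
  set s : CommRingCat.of R₀ ⟶ Γ(X, V) := (Scheme.ΓSpecIso (.of R₀)).inv ≫ p.appLE ⊤ V le_top with hs
  set ψ₀ : Γ(X, V) ⟶ CommRingCat.of B₀ := f₀.appLE V ⊤ hf₀.ge ≫ (Scheme.ΓSpecIso (.of B₀)).hom with hψ₀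
  letI : Algebra R₀ Γ(X, V) := s.hom.toAlgebra
  haveI : Algebra.FormallySmooth R₀ Γ(X, V) := formallySmooth_sections_of_smooth p hV
  have e₀ : f₀ = Spec.map ψ₀ ≫ hV.fromSpec := eq_specMap_appLE_comp_fromSpec hV f₀ hf₀
  have c₀ : s ≫ ψ₀ = CommRingCat.ofHom (algebraMap R₀ B₀) :=
    (comp_eq_specMap_algebraMap_iff hV p ψ₀).mp (e₀ ▸ w₀)
  -- the chart of `f₀` as an `R₀`-algebra homomorphism
  let φ₀ : Γ(X, V) →ₐ[R₀] B₀ :=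
    { ψ₀.hom with
      commutes' := fun c => by
        change ψ₀.hom (s.hom c) = algebraMap R₀ B₀ c
        exact congrArg (fun f : CommRingCat.of R₀ ⟶ CommRingCat.of B₀ => f.hom c) c₀ }
  -- lift it along `π` by formal smoothness
  let φ : Γ(X, V) →ₐ[R₀] B := Algebra.FormallySmooth.liftOfSurjective φ₀ π hπ hnil
  have hφ : π.comp φ = φ₀ := Algebra.FormallySmooth.comp_liftOfSurjective φ₀ π hπ hnil
  let ψ : Γ(X, V) ⟶ CommRingCat.of B := CommRingCat.ofHom φ.toRingHom
  refine ⟨Spec.map ψ ≫ hV.fromSpec, preimage_specMap_comp_fromSpec hV ψ, ?_, ?_⟩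
  · -- an `R₀`-morphism: `s ≫ ψ = algebraMap`
    refine (comp_eq_specMap_algebraMap_iff hV p ψ).mpr ?_
    ext c
    change φ (s.hom c) = algebraMap R₀ B c
    exact φ.commutes c
  · -- reduction: `Spec π ≫ Spec ψ ≫ (V ↪ X) = Spec (π ∘ φ) ≫ (V ↪ X) = Spec ψ₀ ≫ (V ↪ X) = f₀`
    rw [specMap_comp_specMap_comp_fromSpec hV (π : B →+* B₀) ψ, e₀]
    congr 2
    ext a
    change π (φ a) = ψ₀.hom a
    exact congrArg (fun h : Γ(X, V) →ₐ[R₀] B₀ => h a) hφ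

end Literature.AlgebraicGeometry.Deformation

end
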